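import Summits.AtomisticToContinuum.HydrodynamicLimit.Theses.ZenoDiameterTransfer

/-!
# Birth skeleton — piece X4 `IdealIsentropy` of the decomposition of `DiluteEntropicTwin`
(stmt-AtomisticToContinuum-12207; crux-strategist, 2026-08-17)

Three stubs and the composition `IdealIsentropy_of` (sorry-free; sorries only in the stubs):
* `stub_entropyBalance` — the local entropy equation of a classical IDEAL-gas Euler solution in conservation
  form, `∂ₜ(ρ𝓈) + div(ρ𝓈 u) = 0` with `ρ𝓈 = ρ(log ρ − 3/2 log(2πθ) − 3/2)` (from the mass, momentum and
  energy equations with `p = ρθ`; Majda 1984 §1.1), typed with the tree's one-sided `timeDerivWithin`;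
* `stub_entropyFields_smooth` — the entropy density and flux of a classical solution are jointly smooth on
  `[0,T') × 𝕋³` (positivity of `ρ, θ` makes `log` smooth);
* `stub_conserved_integral` — a smooth density obeying a conservation law on the torus has constant integral
  on `[0,T')` (divergence theorem `Torus.integral_divergence_eq_zero_holds`, differentiation under `∫`,
  vanishing one-sided derivative ⇒ constant).
-/

namespace Summit.AtomisticToContinuum.HydrodynamicLimit.Cruxes.DiluteEntropicTwin.IdealIsentropy

set_option linter.dupNamespace false

open scoped BigOperators Topology ENNReal
open Filter Set MeasureTheory

/-- The piece (verbatim the staged sub-item `IdealIsentropy`). -/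
def IdealIsentropy : Prop :=
  ∀ (T' : ℝ) (ρ' θ' : ℝ → Literature.MathematicalPhysics.KineticTheory.T3 → ℝ) (u' : ℝ → Literature.MathematicalPhysics.KineticTheory.T3 → Literature.MathematicalPhysics.KineticTheory.V3), Literature.MathematicalPhysics.KineticTheory.IsHardSphereEulerSolution 0 T' ρ' u' θ' → ∀ s ∈ Set.Ico 0 T', (∫ x, ρ' s x * (Real.log (ρ' s x) - 3 / 2 * Real.log (2 * Real.pi * θ' s x) - 3 / 2)) = (∫ x, ρ' 0 x * (Real.log (ρ' 0 x) - 3 / 2 * Real.log (2 * Real.pi * θ' 0 x) - 3 / 2))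

/-- Stub 1 — local entropy balance of classical ideal-gas Euler solutions. -/
theorem stub_entropyBalance :
    ∀ (T' : ℝ) (ρ' θ' : ℝ → Literature.MathematicalPhysics.KineticTheory.T3 → ℝ) (u' : ℝ → Literature.MathematicalPhysics.KineticTheory.T3 → Literature.MathematicalPhysics.KineticTheory.V3), Literature.MathematicalPhysics.KineticTheory.IsHardSphereEulerSolution 0 T' ρ' u' θ' → ∀ t ∈ Set.Ico 0 T', ∀ x, Literature.Analysis.FunctionSpaces.Torus.timeDerivWithin (Set.Ico 0 T') (fun s y => ρ' s y * (Real.log (ρ' s y) - 3 / 2 * Real.log (2 * Real.pi * θ' s y) - 3 / 2)) t x + Literature.Analysis.FunctionSpaces.Torus.divergence (fun y => (ρ' t y * (Real.log (ρ' t y) - 3 / 2 * Real.log (2 * Real.pi * θ' t y) - 3 / 2)) • u' t y) x = 0 := by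
  sorry

/-- Stub 2 — smoothness of the entropy density and flux. -/
theorem stub_entropyFields_smooth :
    ∀ (T' : ℝ) (ρ' θ' : ℝ → Literature.MathematicalPhysics.KineticTheory.T3 → ℝ) (u' : ℝ → Literature.MathematicalPhysics.KineticTheory.T3 → Literature.MathematicalPhysics.KineticTheory.V3), Literature.MathematicalPhysics.KineticTheory.IsHardSphereEulerSolution 0 T' ρ' u' θ' → Literature.Analysis.FunctionSpaces.Torus.IsSmoothSpaceTimeOn (Set.Ico 0 T') (fun s y => ρ' s y * (Real.log (ρ' s y) - 3 / 2 * Real.log (2 * Real.pi * θ' s y) - 3 / 2)) ∧ Literature.Analysis.FunctionSpaces.Torus.IsSmoothSpaceTimeOn (Set.Ico 0 T') (fun s y => (ρ' s y * (Real.log (ρ' s y) - 3 / 2 * Real.log (2 * Real.pi * θ' s y) - 3 / 2)) • u' s y) := by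
  sorry

/-- Stub 3 — conserved densities have constant integral on the torus. -/
theorem stub_conserved_integral :
    ∀ (T : ℝ) (h : ℝ → Literature.MathematicalPhysics.KineticTheory.T3 → ℝ) (J : ℝ → Literature.MathematicalPhysics.KineticTheory.T3 → Literature.MathematicalPhysics.KineticTheory.V3), Literature.Analysis.FunctionSpaces.Torus.IsSmoothSpaceTimeOn (Set.Ico 0 T) h → Literature.Analysis.FunctionSpaces.Torus.IsSmoothSpaceTimeOn (Set.Ico 0 T) J → (∀ t ∈ Set.Ico 0 T, ∀ x, Literature.Analysis.FunctionSpaces.Torus.timeDerivWithin (Set.Ico 0 T) h t x + Literature.Analysis.FunctionSpaces.Torus.divergence (J t) x = 0) → ∀ t ∈ Set.Ico 0 T, (∫ x, h t x) = ∫ x, h 0 x := by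
  sorry

/-- **Composition** (kernel-checked). -/
theorem IdealIsentropy_of : IdealIsentropy := by
  have hS1 := stub_entropyBalance
  have hS2 := stub_entropyFields_smooth
  have hS3 := stub_conserved_integral
  intro T' ρ' θ' u' hE s hs
  obtain ⟨hh, hJ⟩ := hS2 T' ρ' θ' u' hE
  exact hS3 T' (fun s y => ρ' s y * (Real.log (ρ' s y) - 3 / 2 * Real.log (2 * Real.pi * θ' s y) - 3 / 2))
    (fun s y => (ρ' s y * (Real.log (ρ' s y) - 3 / 2 * Real.log (2 * Real.pi * θ' s y) - 3 / 2)) • u' s y) hh hJ (fun t ht x => hS1 T' ρ' θ' u' hE t ht x) s hs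

end Summit.AtomisticToContinuum.HydrodynamicLimit.Cruxes.DiluteEntropicTwin.IdealIsentropy
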